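import Summits.PneNP.PneNP.Theses.KarlinRubin
import Summits.PneNP.PneNP.Theorems.KarlinRubinMonotoneBlindDnfBlind
import Literature.Probability.Moments.DisjointCoordinates

/-!
# Route KarlinRubin, crux `MonotoneBlind` (stmt-PneNP-18027), line `Sketch`: stub `stub_hingeDnf`

The HINGE form of the DNF theorem, with NO quietness hypothesis (stub `stub_hingeDnf` of the skeleton of line
`Sketch`, a rung of its hard stub `stub_noDeepHinge`). For a planted set `A` and a noise `x`, resample the slots
inside `A`: `mix A x x' := fun e => if (∀ v ∈ e, v ∈ A) then x' e else x e`; the FIBRE DENSITY of a test `f` at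
`(x, A)` is `Pr_{x'}[f (mix A x x') = 1]` and the HINGE MASS of `f` at level `η` is
`(#kSubsets)⁻¹ Σ_A Pr_x[f (plant A x) = 1 ∧ density ≤ η]`.

**Theorem** (`stub_hingeDnf`): for `0 < δ < 1/2`, `c : ℕ` and term families `𝓔 n` with `#(𝓔 n) ≤ n^c`
eventually, the monotone DNF `x ↦ [∃ E ∈ 𝓔 n, E ⊆ x]` has hinge mass `→ 0` at the level `η = 2^{-(t+1)}`,
`t = C(2(c+2)-1, 2)`, planted size `⌈n^{1/2-δ}⌉`.

Proof. (a) LIGHT WITNESS ⇒ DENSE FIBRE (`half_pow_card_filter_le_dens`): if `E ⊆ plant A x` then every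
`x'` that is on along the slots of `E` inside `A` has `E ⊆ mix A x x'` (outside `A`, `mix = x = plant A x`), so the
density is `≥ 2^{-#(E ∩ inside A)}` (exact cylinder count `card_filter_forall_eq_true_mul_eq`). Hence on the hinge
event every witness term is HEAVY (`> t` slots inside `A`), and the hinge event lies in the union of
`{x | E ⊆ plant A x}` over the heavy terms (`hinge_le_sum_heavy`). (b) Averaging over `A` and exchanging sums, the
hinge mass is at most `Σ_E (#kSubsets)⁻¹ Σ_A [t < t_A(E)] Pr_x[E ⊆ plant A x] ≤ #(𝓔 n) · 2 (n^{c+2})⁻¹ ≤ 2 (n²)⁻¹`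
by the landed uniform per-term bound `dnf_termBound_two_inv` under its numeric hypotheses
(`hingeMass_dnf_le`), which hold eventually (`eventually_H1/H2/H3`). (c) Squeeze.

All `--supports stmt-PneNP-18027`; no definitions.
-/

set_option linter.dupNamespace false -- `Summit.PneNP.PneNP.…` is the layout-mandated namespace

namespace Summit.PneNP.PneNP.Theorems.MonotoneBlind.VertexCover

open Literature.Computability.Complexity Literature.Probability.RandomGraphs.PlantedClique Filter Finset
open scoped ENNReal Topology Classical

/-! ### (a) A light witness makes the fibre dense -/

/-- **Cylinder probability, lower bound.** Under `G(n,1/2)` a fixed set `D` of slots is entirely on with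
probability `≥ 2^{-|D|}` (in fact exactly; from the cylinder count `#{x : x|_D ≡ 1} · 2^{|D|} = 2^{#slots}`).
[folklore] -/
theorem half_pow_card_le_toOuterMeasure_forall {n : ℕ} (D : Finset (⊤ : SimpleGraph (Fin n)).edgeSet) :
    (2⁻¹ : ℝ≥0∞) ^ #D ≤ (erdosRenyiHalf n).toOuterMeasure {x | ∀ e ∈ D, x e = true} := by
  have hcount := Literature.Probability.Moments.card_filter_forall_eq_true_mul_eq D
  have huniv : (Fintype.card (EdgeVec n) : ℝ≥0∞) = 2 ^ Fintype.card (⊤ : SimpleGraph (Fin n)).edgeSet := by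
    rw [Fintype.card_fun, Fintype.card_bool]; push_cast; rfl
  have h2 : (2 : ℝ≥0∞) ^ #D ≠ 0 := pow_ne_zero _ two_ne_zero
  have h2' : (2 : ℝ≥0∞) ^ #D ≠ ⊤ := ENNReal.pow_ne_top ENNReal.ofNat_ne_top
  have hF : (univ.filter fun x : EdgeVec n => x ∈ {x : EdgeVec n | ∀ e ∈ D, x e = true}) =
      univ.filter fun x : EdgeVec n => ∀ e ∈ D, x e = true := by
    ext x; simp
  rw [erdosRenyiHalf_toOuterMeasure_eq_card_div, huniv,
    ENNReal.le_div_iff_mul_le (Or.inl (pow_ne_zero _ two_ne_zero))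
      (Or.inl (ENNReal.pow_ne_top ENNReal.ofNat_ne_top)), hF]
  calc (2⁻¹ : ℝ≥0∞) ^ #D * 2 ^ Fintype.card (⊤ : SimpleGraph (Fin n)).edgeSet
      = 2⁻¹ ^ #D * (((#(univ.filter fun x : EdgeVec n => ∀ e ∈ D, x e = true) : ℕ) : ℝ≥0∞) * 2 ^ #D) := by
        congr 1
        exact_mod_cast hcount.symm
    _ ≤ ((#(univ.filter fun x : EdgeVec n => ∀ e ∈ D, x e = true) : ℕ) : ℝ≥0∞) := by
        rw [mul_comm, mul_assoc, ← ENNReal.inv_pow, ENNReal.mul_inv_cancel h2 h2', mul_one]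

/-- **Light witness ⇒ dense fibre.** If the term `E ∈ 𝓔` lies in `plant A x`, then the fibre density of the DNF
`[∃ E ∈ 𝓔, E ⊆ ·]` at `(x, A)` is at least `2^{-#(slots of E inside A)}`: every `x'` that is on along the slots
of `E` inside `A` has `E ⊆ mix A x x'`, because off `A` the mixed vector is `x`, which agrees with `plant A x`
there. [folklore] -/
theorem half_pow_card_filter_le_dens {n : ℕ} (A : Finset (Fin n)) (x : EdgeVec n)
    (𝓔 : Finset (Finset (⊤ : SimpleGraph (Fin n)).edgeSet)) {E : Finset (⊤ : SimpleGraph (Fin n)).edgeSet}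
    (hE : E ∈ 𝓔) (hEx : ∀ e ∈ E, plant A x e = true) :
    (2⁻¹ : ℝ≥0∞) ^ #(E.filter fun e : (⊤ : SimpleGraph (Fin n)).edgeSet => ∀ v ∈ (e : Sym2 (Fin n)), v ∈ A) ≤
      (erdosRenyiHalf n).toOuterMeasure
        {x' | ∃ E ∈ 𝓔, ∀ e ∈ E, (if (∀ v ∈ (e : Sym2 (Fin n)), v ∈ A) then x' e else x e) = true} := by
  refine (half_pow_card_le_toOuterMeasure_forall _).trans ((erdosRenyiHalf n).toOuterMeasure.mono ?_)
  intro x' hx'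
  simp only [Set.mem_setOf_eq] at hx' ⊢
  refine ⟨E, hE, fun e he => ?_⟩
  by_cases heA : ∀ v ∈ (e : Sym2 (Fin n)), v ∈ A
  · rw [if_pos heA]
    exact hx' e (mem_filter.2 ⟨he, heA⟩)
  · rw [if_neg heA, ← plant_apply_of_not_inside A x e heA]
    exact hEx e he

/-- **On the hinge event every witness is heavy** (union bound). At level `2^{-(t+1)}`, a planted input in the
hinge event has all its witness terms with `> t` slots inside `A` (a witness with `≤ t` inside slots gives
density `≥ 2^{-t} > 2^{-(t+1)}`, `half_pow_card_filter_le_dens`); so the hinge event lies in the union over the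
`t`-heavy terms `E` of `{x | E ⊆ plant A x}`, and its probability is at most the corresponding sum. [folklore] -/
theorem hinge_le_sum_heavy {n : ℕ} (A : Finset (Fin n)) (𝓔 : Finset (Finset (⊤ : SimpleGraph (Fin n)).edgeSet))
    (t : ℕ) :
    (erdosRenyiHalf n).toOuterMeasure
        {x | (∃ E ∈ 𝓔, ∀ e ∈ E, plant A x e = true) ∧
          (erdosRenyiHalf n).toOuterMeasure
            {x' | ∃ E ∈ 𝓔, ∀ e ∈ E, (if (∀ v ∈ (e : Sym2 (Fin n)), v ∈ A) then x' e else x e) = true} ≤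
              2⁻¹ ^ (t + 1)} ≤
      ∑ E ∈ 𝓔,
        if t < #(E.filter fun e : (⊤ : SimpleGraph (Fin n)).edgeSet => ∀ v ∈ (e : Sym2 (Fin n)), v ∈ A) then
          (erdosRenyiHalf n).toOuterMeasure {x | ∀ e ∈ E, plant A x e = true} else 0 := by
  set Heavy := 𝓔.filter fun E =>
    t < #(E.filter fun e : (⊤ : SimpleGraph (Fin n)).edgeSet => ∀ v ∈ (e : Sym2 (Fin n)), v ∈ A) with hHeavy
  have htwo : (2⁻¹ : ℝ≥0∞) ≤ 1 := ENNReal.inv_le_one.2 one_le_two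
  have hsub : {x | (∃ E ∈ 𝓔, ∀ e ∈ E, plant A x e = true) ∧
        (erdosRenyiHalf n).toOuterMeasure
          {x' | ∃ E ∈ 𝓔, ∀ e ∈ E, (if (∀ v ∈ (e : Sym2 (Fin n)), v ∈ A) then x' e else x e) = true} ≤
            2⁻¹ ^ (t + 1)} ⊆
      ⋃ E ∈ Heavy, {x | ∀ e ∈ E, plant A x e = true} := by
    rintro x ⟨⟨E, hE, hEx⟩, hdens⟩
    refine Set.mem_biUnion (x := E) (mem_filter.2 ⟨hE, ?_⟩) hEx
    by_contra hle
    rw [not_lt] at hle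
    -- a light witness: density `≥ 2^{-t}`, contradicting `≤ 2^{-(t+1)}`
    have ha0 : (2⁻¹ : ℝ≥0∞) ^ t ≠ 0 := pow_ne_zero _ (ENNReal.inv_ne_zero.2 ENNReal.ofNat_ne_top)
    have hatop : (2⁻¹ : ℝ≥0∞) ^ t ≠ ⊤ := ENNReal.pow_ne_top (ENNReal.inv_ne_top.2 two_ne_zero)
    have hchain : (2⁻¹ : ℝ≥0∞) ^ t ≤ 2⁻¹ ^ t / 2 :=
      calc (2⁻¹ : ℝ≥0∞) ^ t
          ≤ 2⁻¹ ^ #(E.filter fun e : (⊤ : SimpleGraph (Fin n)).edgeSet => ∀ v ∈ (e : Sym2 (Fin n)), v ∈ A) :=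
            pow_le_pow_right_of_le_one' htwo hle
        _ ≤ 2⁻¹ ^ (t + 1) := (half_pow_card_filter_le_dens A x 𝓔 hE hEx).trans hdens
        _ = 2⁻¹ ^ t / 2 := by rw [pow_succ, div_eq_mul_inv]
    exact absurd hchain (not_le.2 (ENNReal.half_lt_self ha0 hatop))
  calc (erdosRenyiHalf n).toOuterMeasure
        {x | (∃ E ∈ 𝓔, ∀ e ∈ E, plant A x e = true) ∧
          (erdosRenyiHalf n).toOuterMeasure
            {x' | ∃ E ∈ 𝓔, ∀ e ∈ E, (if (∀ v ∈ (e : Sym2 (Fin n)), v ∈ A) then x' e else x e) = true} ≤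
              2⁻¹ ^ (t + 1)}
      ≤ (erdosRenyiHalf n).toOuterMeasure (⋃ E ∈ Heavy, {x | ∀ e ∈ E, plant A x e = true}) :=
        (erdosRenyiHalf n).toOuterMeasure.mono hsub
    _ ≤ ∑ E ∈ Heavy, (erdosRenyiHalf n).toOuterMeasure {x | ∀ e ∈ E, plant A x e = true} :=
        MeasureTheory.measure_biUnion_finset_le _ _
    _ = _ := by rw [hHeavy, sum_filter]

/-! ### (b) The hinge mass per `n` -/

/-- **Per-`n` hinge-mass bound.** Under the numeric hypotheses of `dnf_termBound_two_inv` and `#𝓔 ≤ n^c`, the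
hinge mass of the DNF `[∃ E ∈ 𝓔, E ⊆ ·]` at level `2^{-(C(2(c+2)-1,2)+1)}` is at most `2 (n²)⁻¹`: average
`hinge_le_sum_heavy` over the planted set, exchange the sums, and bound each term's heavy-witness term by
`2 (n^{c+2})⁻¹` (`dnf_termBound_two_inv`). [folklore] -/
theorem hingeMass_dnf_le {n : ℕ} (hn : 0 < n) (k : ℕ) {L c : ℕ}
    (H1 : (2 * L ^ 4 * (min k n)) ^ 2 ≤ n) (H2 : 12 * (Nat.sqrt n + 1) * (min k n) ≤ n)
    (H3 : 6 * (min k n) ≤ Nat.sqrt n + 1) (hL : c + 3 ≤ L) (hnL : n < 2 ^ (L + 1))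
    (𝓔 : Finset (Finset (⊤ : SimpleGraph (Fin n)).edgeSet)) (hM : #𝓔 ≤ n ^ c) :
    ((#(kSubsets n k) : ℕ) : ℝ≥0∞)⁻¹ *
        ∑ A ∈ kSubsets n k, (erdosRenyiHalf n).toOuterMeasure
          {x | (∃ E ∈ 𝓔, ∀ e ∈ E, plant A x e = true) ∧
            (erdosRenyiHalf n).toOuterMeasure
              {x' | ∃ E ∈ 𝓔, ∀ e ∈ E,
                (if (∀ v ∈ (e : Sym2 (Fin n)), v ∈ A) then x' e else x e) = true} ≤
              2⁻¹ ^ ((2 * (c + 2) - 1).choose 2 + 1)} ≤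
      2 * (((n ^ 2 : ℕ) : ℝ≥0∞))⁻¹ := by
  set t := (2 * (c + 2) - 1).choose 2 with ht
  calc ((#(kSubsets n k) : ℕ) : ℝ≥0∞)⁻¹ *
        ∑ A ∈ kSubsets n k, (erdosRenyiHalf n).toOuterMeasure
          {x | (∃ E ∈ 𝓔, ∀ e ∈ E, plant A x e = true) ∧
            (erdosRenyiHalf n).toOuterMeasure
              {x' | ∃ E ∈ 𝓔, ∀ e ∈ E,
                (if (∀ v ∈ (e : Sym2 (Fin n)), v ∈ A) then x' e else x e) = true} ≤ 2⁻¹ ^ (t + 1)}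
      ≤ ((#(kSubsets n k) : ℕ) : ℝ≥0∞)⁻¹ * ∑ A ∈ kSubsets n k, ∑ E ∈ 𝓔,
          (if t < #(E.filter fun e : (⊤ : SimpleGraph (Fin n)).edgeSet => ∀ v ∈ (e : Sym2 (Fin n)), v ∈ A) then
            (erdosRenyiHalf n).toOuterMeasure {x | ∀ e ∈ E, plant A x e = true} else 0) := by
        gcongr with A hA
        exact hinge_le_sum_heavy A 𝓔 t
    _ = ∑ E ∈ 𝓔, ((#(kSubsets n k) : ℕ) : ℝ≥0∞)⁻¹ * ∑ A ∈ kSubsets n k,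
          (if t < #(E.filter fun e : (⊤ : SimpleGraph (Fin n)).edgeSet => ∀ v ∈ (e : Sym2 (Fin n)), v ∈ A) then
            (erdosRenyiHalf n).toOuterMeasure {x | ∀ e ∈ E, plant A x e = true} else 0) := by
        rw [sum_comm, mul_sum]
    _ ≤ ∑ E ∈ 𝓔, 2 * (((n ^ (c + 2) : ℕ) : ℝ≥0∞))⁻¹ :=
        sum_le_sum fun E _ => dnf_termBound_two_inv hn k H1 H2 H3 hL hnL E
    _ ≤ 2 * (((n ^ 2 : ℕ) : ℝ≥0∞))⁻¹ := by
        rw [sum_const, nsmul_eq_mul]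
        calc (#𝓔 : ℝ≥0∞) * (2 * (((n ^ (c + 2) : ℕ) : ℝ≥0∞))⁻¹)
            ≤ ((n ^ c : ℕ) : ℝ≥0∞) * (2 * (((n ^ (c + 2) : ℕ) : ℝ≥0∞))⁻¹) :=
              mul_le_mul' (by exact_mod_cast hM) le_rfl
          _ = 2 * (((n ^ c : ℕ) : ℝ≥0∞) * (((n ^ (c + 2) : ℕ) : ℝ≥0∞))⁻¹) := by ring
          _ = 2 * (((n ^ 2 : ℕ) : ℝ≥0∞))⁻¹ := by rw [natCast_pow_mul_inv_pow_add_two hn c]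

/-! ### (c) The stub -/

/-- **stub_hingeDnf** (hinge form of the DNF theorem, NO quietness). For `δ ∈ (0,1/2)`, `c`, and term
families `𝓔 n` with `#(𝓔 n) ≤ n^c` eventually, the monotone DNF `x ↦ [∃ E ∈ 𝓔 n, E ⊆ x]` has vanishing
hinge mass at the level `η = 2^{-(C(2(c+2)-1, 2) + 1)}`: in a hinged pair `(A, x)` every witness term
`E ⊆ plant A x` has `> t` slots inside `A` (a witness with `≤ t` inside slots gives density `≥ 2^{-t}`), and the
mass of planted inputs all of whose witnesses are `t`-heavy is `≤ 2/n²` eventually (`hingeMass_dnf_le` with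
`eventually_H1/H2/H3` of `KarlinRubinMonotoneBlindDnfBlind`); squeeze. [folklore] -/
theorem stub_hingeDnf :
    ∀ δ : ℝ, 0 < δ → δ < 1 / 2 → ∀ c : ℕ,
      ∀ 𝓔 : (n : ℕ) → Finset (Finset ((⊤ : SimpleGraph (Fin n)).edgeSet)),
      (∀ᶠ n : ℕ in atTop, #(𝓔 n) ≤ n ^ c) →
      ∃ η : ℝ≥0∞, 0 < η ∧
        Tendsto (fun n : ℕ =>
          ((#(kSubsets n ⌈(n : ℝ) ^ (1 / 2 - δ)⌉₊) : ℕ) : ℝ≥0∞)⁻¹ *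
            ∑ A ∈ kSubsets n ⌈(n : ℝ) ^ (1 / 2 - δ)⌉₊, (erdosRenyiHalf n).toOuterMeasure
              {x | (∃ E ∈ 𝓔 n, ∀ e ∈ E, plant A x e = true) ∧
                (erdosRenyiHalf n).toOuterMeasure
                  {x' | ∃ E ∈ 𝓔 n, ∀ e ∈ E,
                    (if (∀ v ∈ (e : Sym2 (Fin n)), v ∈ A) then x' e else x e) = true} ≤ η}) atTop (𝓝 0) := by
  intro δ hδ hδ' c 𝓔 hM
  refine ⟨2⁻¹ ^ ((2 * (c + 2) - 1).choose 2 + 1),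
    ENNReal.pow_pos (ENNReal.inv_pos.2 ENNReal.ofNat_ne_top) _, ?_⟩
  -- the bound `2 (n²)⁻¹ → 0`
  have hinv : Tendsto (fun n : ℕ => (((n ^ 2 : ℕ) : ℝ≥0∞))⁻¹) atTop (𝓝 0) := by
    refine tendsto_of_tendsto_of_tendsto_of_le_of_le' tendsto_const_nhds ENNReal.tendsto_inv_nat_nhds_zero
      (Eventually.of_forall fun _ => bot_le) ?_
    filter_upwards [eventually_ge_atTop 1] with n hn
    apply ENNReal.inv_le_inv.2
    exact_mod_cast (Nat.le_self_pow two_ne_zero n)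
  have hbound : Tendsto (fun n : ℕ => 2 * (((n ^ 2 : ℕ) : ℝ≥0∞))⁻¹) atTop (𝓝 0) := by
    have h2 := ENNReal.Tendsto.const_mul hinv
      (Or.inr ENNReal.ofNat_ne_top : (0 : ℝ≥0∞) ≠ 0 ∨ (2 : ℝ≥0∞) ≠ ⊤)
    simpa using h2
  refine tendsto_of_tendsto_of_tendsto_of_le_of_le' tendsto_const_nhds hbound
    (Eventually.of_forall fun _ => bot_le) ?_
  have hL : ∀ᶠ n : ℕ in atTop, c + 3 ≤ Nat.log 2 n := by
    filter_upwards [eventually_ge_atTop (2 ^ (c + 3))] with n hn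
    exact Nat.le_log_of_pow_le one_lt_two hn
  filter_upwards [hM, eventually_H1 hδ hδ', eventually_H2 hδ hδ', eventually_H3 hδ hδ', hL,
    eventually_ge_atTop 1] with n hMn H1 H2 H3 hLn hn1
  exact hingeMass_dnf_le hn1 _ H1 H2 H3 hLn (Nat.lt_pow_succ_log_self one_lt_two n) (𝓔 n) hMn

end Summit.PneNP.PneNP.Theorems.MonotoneBlind.VertexCover
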